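import Literature.MathematicalPhysics.QuantumLattice.GrassmannCumulantKernelBound
import Literature.MathematicalPhysics.QuantumLattice.GrassmannIntegralBerezinProofs
import HarnessLib

/-!
# The kernel expansion `F = Σ_m Σ_Y kernel F m Y · ψ(Y)` and the kernel presentation of an even element

Topic `Literature/MathematicalPhysics/QuantumLattice`.  The reconstruction of an element of the Grassmann
algebra on the finite label set `Γ` from its antisymmetric kernels (Salmhofer 1998, (3.12); Salmhofer 1999,
(4.95); Berezin 1966, Ch. I §3 (3.3)):

`F = Σ_{m ≤ |Γ|} presented R (kernel R F m)`  (`eq_sum_presented_kernel`),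

and, for an EVEN element, the presentation by its even-degree kernels as a `vertexOf`
(`GrassmannCumulantKernelBound.lean`): `V = vertexOf (range (|Γ|/2 + 1)) (m' ↦ kernel V (2m'))`
(`coe_vertexOf_kernel_eq`) — the adapter by which the single-scale bound
`sum_norm_kernel_cumulantOf_le` applies to an arbitrary even interaction.  (The reconstruction theorem was
first proved in the tree under `Summits/HubbardSuperconductivity/…/AposterioriCapRgSeededBrokenRegimeBoseFermiPinnedKernelExpansion`
(crux stmt-HubbardSuperconductivity-14047, lead c4); it is generic and is re-proved here so that the Literature
engine can use it.)

* `presented_add`, `presented_smul`, `presented_zero`, `genProd_eq_presented_single`, `sum_comp_perm_smul_genProd`,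
  `grassmannBasis_eq_genProd'`;
* `presented_kernel_presented` (`presented (kernel (presented φ) k) = presented φ`), `presented_eq_sum_presented_kernel`,
  **`eq_sum_presented_kernel`**;
* `kernel_eq_zero_of_mem_evenPart_of_odd` (odd kernels of an even element vanish), **`coe_vertexOf_kernel_eq`**.

Everything is proved; no named fact.

## Sources

M. Salmhofer, Commun. Math. Phys. 194 (1998) 249–295, §3.2 (3.12) (`Salmhofer1998`); M. Salmhofer,
*Renormalization* (1999), §4.3 (4.95) (`Salmhofer1999`); F. A. Berezin, *The Method of Second Quantization*
(1966), Ch. I §3 (3.3) (`Berezin1966`).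
-/

noncomputable section

namespace Literature.MathematicalPhysics.QuantumLattice

open GrassmannAlgebra Finset

section Presented

variable (R : Type*) [CommRing R] {Γ : Type*} [DecidableEq Γ] [Fintype Γ]

/-- `presented` is additive in the presentation. [folklore] -/
theorem presented_add {k : ℕ} (φ ψ : (Fin k → Γ) → R) : presented R (φ + ψ) = presented R φ + presented R ψ := by
  simp only [presented, Pi.add_apply, add_smul, sum_add_distrib]

/-- `presented` is homogeneous in the presentation. [folklore] -/
theorem presented_smul {k : ℕ} (r : R) (φ : (Fin k → Γ) → R) : presented R (r • φ) = r • presented R φ := by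
  simp only [presented, Pi.smul_apply, smul_eq_mul, mul_smul, smul_sum]

/-- The zero presentation presents `0`. [folklore] -/
theorem presented_zero {k : ℕ} : presented R (0 : (Fin k → Γ) → R) = 0 := by
  simp [presented]

/-- A product of generators is presented by a delta presentation. [folklore] -/
theorem genProd_eq_presented_single {k : ℕ} (Y : Fin k → Γ) : genProd R Y = presented R (Pi.single Y (1 : R)) := by
  rw [presented, sum_eq_single Y (fun Z _ hZ => by rw [Pi.single_eq_of_ne hZ, zero_smul]) (fun h => absurd (mem_univ Y) h),
    Pi.single_eq_same, one_smul]

/-- **Re-indexing a presentation by a permutation of the slots**: `Σ_X φ(X ∘ σ) • ψ(X) = sign σ • presented φ`.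
[folklore] -/
theorem sum_comp_perm_smul_genProd {k : ℕ} (φ : (Fin k → Γ) → R) (σ : Equiv.Perm (Fin k)) :
    ∑ X : Fin k → Γ, φ (X ∘ σ) • genProd R X = ((Equiv.Perm.sign σ : ℤ) : R) • presented R φ := by
  rw [presented, smul_sum]
  refine Fintype.sum_bijective (fun X : Fin k → Γ => X ∘ σ)
    (Function.bijective_iff_has_inverse.2 ⟨fun Z => Z ∘ σ.symm, fun X => ?_, fun Z => ?_⟩) _ _ fun X => ?_
  · funext i
    simp
  · funext i
    simp
  · rw [genProd_comp_perm, smul_smul, smul_smul, mul_right_comm, ← Int.cast_mul, Int.units_coe_mul_self, Int.cast_one, one_mul]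

/-- A monomial basis vector is the increasing product of its generators, as a `genProd`. [folklore] -/
theorem grassmannBasis_eq_genProd' [LinearOrder Γ] (s : Finset Γ) :
    grassmannBasis R Γ s = genProd R (fun i : Fin s.card => s.orderEmbOfFin rfl i) := by
  rw [grassmannBasis_eq_prod_map_gen, genProd, List.ofFn_eq_map, ← Finset.listMap_orderEmbOfFin_finRange s rfl, List.map_map]
  -- (the two sides use the `DecidableEq` instances of the section and of the linear order)
  congr 2
  funext i
  simp only [Function.comp_apply]
  congr 1
  exact Subsingleton.elim _ _

variable [Algebra ℚ R]

/-- **Re-presenting the kernel of a presented polynomial gives it back**: `presented (kernel (presented φ) k) = presented φ`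
(the antisymmetrisation `(k!)⁻¹ Σ_σ sign σ · φ(X ∘ σ)` presents the same polynomial). [cite: Salmhofer1999, §4.3 (4.95)] -/
theorem presented_kernel_presented {k : ℕ} (φ : (Fin k → Γ) → R) :
    presented R (kernel R (presented R φ) k) = presented R φ := by
  have hk : kernel R (presented R φ) k = fun X =>
      ((k.factorial : ℚ)⁻¹ • (1 : R)) * ∑ σ : Equiv.Perm (Fin k), ((Equiv.Perm.sign σ : ℤ) : R) * φ (X ∘ σ) := by
    funext X
    rw [kernel_presented]
    simp only [Units.smul_def, zsmul_eq_mul]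
  have hc : ((k.factorial : ℚ)⁻¹ • (1 : R)) * ((k.factorial : ℕ) : R) = 1 := by
    rw [← mul_one ((k.factorial : ℕ) : R), ← nsmul_eq_mul, ← Nat.cast_smul_eq_nsmul ℚ, smul_mul_smul_comm,
      one_mul, inv_mul_cancel₀ (by positivity), one_smul]
  conv_lhs => rw [hk, presented]
  simp_rw [mul_smul, ← smul_sum, sum_smul]
  rw [sum_comm]
  simp_rw [mul_smul, ← smul_sum, sum_comp_perm_smul_genProd, smul_smul, ← Int.cast_mul,
    Int.units_coe_mul_self, Int.cast_one, one_smul, sum_const, card_univ, Fintype.card_perm,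
    Fintype.card_fin, ← Nat.cast_smul_eq_nsmul R, smul_smul, hc, one_smul]

/-- The expansion theorem on a presented polynomial of degree `k ≤ |Γ|`: only the degree `k` survives.
[cite: Salmhofer1998, §3.2 (3.12)] -/
theorem presented_eq_sum_presented_kernel {k : ℕ} (φ : (Fin k → Γ) → R) (hk : k ≤ Fintype.card Γ) :
    presented R φ = ∑ m ∈ range (Fintype.card Γ + 1), presented R (kernel R (presented R φ) m) := by
  rw [sum_eq_single_of_mem k (mem_range.2 (Nat.lt_succ_of_le hk)) fun m _ hmk => ?_, presented_kernel_presented]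
  have h0 : kernel R (presented R φ) m = 0 := funext fun X => kernel_presented_of_ne R φ X hmk
  rw [h0, presented_zero]

/-- The expansion theorem on a monomial basis vector. [cite: Salmhofer1998, §3.2 (3.12)] -/
theorem grassmannBasis_eq_sum_presented_kernel [LinearOrder Γ] (s : Finset Γ) :
    grassmannBasis R Γ s = ∑ m ∈ range (Fintype.card Γ + 1), presented R (kernel R (grassmannBasis R Γ s) m) := by
  rw [grassmannBasis_eq_genProd' R s, genProd_eq_presented_single]
  exact presented_eq_sum_presented_kernel R _ (card_le_univ s)

/-- **The kernel expansion theorem** `F = Σ_{m ≤ |Γ|} Σ_Y kernel F m Y · ψ(Y_0)⋯ψ(Y_{m-1})` (Salmhofer 1998, (3.12);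
Salmhofer 1999, (4.95); Berezin 1966, (3.3)). [cite: Salmhofer1998, §3.2 (3.12)] -/
theorem eq_sum_presented_kernel (F : GrassmannAlgebra R Γ) :
    F = ∑ m ∈ range (Fintype.card Γ + 1), presented R (kernel R F m) := by
  letI : LinearOrder Γ := LinearOrder.lift' (Fintype.equivFin Γ) (Fintype.equivFin Γ).injective
  have hF := (grassmannBasis R Γ).mem_span F
  induction hF using Submodule.span_induction with
  | mem x hx =>
    obtain ⟨s, rfl⟩ := hx
    exact grassmannBasis_eq_sum_presented_kernel R s
  | zero => simp [presented]
  | add x y _ _ hx hy =>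
    conv_lhs => rw [hx, hy]
    rw [← sum_add_distrib]
    refine sum_congr rfl fun m _ => ?_
    rw [← presented_add]
    congr 1
    funext X
    rw [Pi.add_apply, kernel_add]
  | smul r x _ hx =>
    conv_lhs => rw [hx]
    rw [smul_sum]
    refine sum_congr rfl fun m _ => ?_
    rw [← presented_smul]
    congr 1
    funext X
    rw [Pi.smul_apply, smul_eq_mul, kernel_smul]

/-! ### Even elements: odd kernels vanish; the presentation as a `vertexOf` -/

omit [DecidableEq Γ] [Algebra ℚ R] in
/-- The constant part of an odd element vanishes. [folklore] -/
theorem constPart_eq_zero_of_mem_evenOdd_one {a : GrassmannAlgebra R Γ} (ha : a ∈ evenOdd R (1 : ZMod 2)) : constPart R a = 0 := by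
  letI : LinearOrder Γ := LinearOrder.lift' (Fintype.equivFin Γ) (Fintype.equivFin Γ).injective
  rw [eq_sum_filter_of_mem_evenOdd R ha, map_sum]
  refine sum_eq_zero fun s hs => ?_
  rw [map_smul, constPart_grassmannBasis, if_neg, smul_zero]
  rintro rfl
  have h := (mem_filter.1 hs).2
  rw [card_empty, Nat.cast_zero] at h
  exact zero_ne_one h

omit [DecidableEq Γ] [Fintype Γ] [Algebra ℚ R] in
/-- The iterated derivative shifts the parity by the number of derivatives. [folklore] -/
theorem iterDeriv_mem_evenOdd : ∀ {m : ℕ} (X : Fin m → Γ) {i : ZMod 2} {a : GrassmannAlgebra R Γ},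
    a ∈ evenOdd R i → iterDeriv R X a ∈ evenOdd R (i + m)
  | 0, X, i, a, ha => by rw [iterDeriv_zero_apply, Nat.cast_zero, add_zero]; exact ha
  | m + 1, X, i, a, ha => by
    rw [iterDeriv_succ_apply]
    have h := iterDeriv_mem_evenOdd (fun j => X j.succ) (grassmannDeriv_mem_evenOdd R (X 0) ha)
    rw [add_assoc] at h
    convert h using 2
    push_cast
    ring

omit [DecidableEq Γ] in
/-- **The odd kernels of an even element vanish.** [folklore] -/
theorem kernel_eq_zero_of_mem_evenPart_of_odd {V : GrassmannAlgebra R Γ} (hV : V ∈ evenPart R Γ) {m : ℕ} (hm : Odd m)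
    (X : Fin m → Γ) : kernel R V m X = 0 := by
  rw [kernel_def, constPart_eq_zero_of_mem_evenOdd_one R ?_, mul_zero]
  have h := iterDeriv_mem_evenOdd R X (mem_evenPart_iff.1 hV)
  rwa [zero_add, (ZMod.natCast_eq_one_iff_odd).2 hm] at h

/-- **An even element is the `vertexOf` of its even-degree kernels**:
`V = Σ_{m' ≤ |Γ|/2} Σ_Y kernel V (2m') Y · ψ(Y)`. [cite: Salmhofer1998, §3.2 (3.12)] -/
theorem coe_vertexOf_kernel_eq (V : evenPart R Γ) :
    (vertexOf R (range (Fintype.card Γ / 2 + 1)) (fun m' => kernel R (V : GrassmannAlgebra R Γ) (2 * m')) : GrassmannAlgebra R Γ) = V := by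
  rw [vertexOf, AddSubmonoidClass.coe_finsetSum]
  conv_rhs => rw [eq_sum_presented_kernel R (V : GrassmannAlgebra R Γ)]
  -- only the even degrees `m = 2m'`, `m ≤ |Γ|`, contribute on the right
  symm
  rw [← sum_filter_add_sum_filter_not (range (Fintype.card Γ + 1)) (fun m => Even m)]
  have hodd : ∑ m ∈ (range (Fintype.card Γ + 1)).filter (fun m => ¬Even m), presented R (kernel R (V : GrassmannAlgebra R Γ) m) = 0 := by
    refine sum_eq_zero fun m hm => ?_
    have hmo : Odd m := Nat.not_even_iff_odd.1 (mem_filter.1 hm).2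
    rw [show kernel R (V : GrassmannAlgebra R Γ) m = 0 from funext fun X => kernel_eq_zero_of_mem_evenPart_of_odd R V.2 hmo X,
      presented_zero]
  rw [hodd, add_zero]
  -- reindex the even degrees by `m = 2m'`
  have himage : (range (Fintype.card Γ + 1)).filter (fun m => Even m) = (range (Fintype.card Γ / 2 + 1)).image (fun m' => 2 * m') := by
    ext m
    simp only [mem_filter, mem_range, mem_image]
    constructor
    · rintro ⟨hm, ⟨m', rfl⟩⟩
      exact ⟨m', by omega, by ring⟩
    · rintro ⟨m', hm', rfl⟩
      exact ⟨by omega, ⟨m', by ring⟩⟩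
  rw [himage, sum_image fun m₁ _ m₂ _ h => by omega]
  refine sum_congr rfl fun m' _ => ?_
  rw [presented, AddSubmonoidClass.coe_finsetSum]
  rfl

end Presented

end Literature.MathematicalPhysics.QuantumLattice
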